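import Summits.BirchSwinnertonDyer.BirchSwinnertonDyer.Theorems.PrintCf2RubinValueTwoFourTermPseudoNull
import Literature.NumberTheory.EllipticCurves.IwasawaAlgebraCharIdealProofs
import Literature.NumberTheory.EllipticCurves.Rubin1991.TwoVariableMainConjecture
import Mathlib.RingTheory.Ideal.Height
import HarnessLib

/-!
# When is a defect pseudo-null? `π`-primary modules with `μ_π = 0` — the criterion that turns the
# «killed by `#Δ′`» defects of the `θ`-coinvariant four-term sequence into pseudo-null modules
# (generic Noetherian domain; specialised to `Λ₂ = ℤ_p⟦T₁,T₂⟧`, `π = p`)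

Cell `bsd-print-cf2`, width seat `bsd-line-cf2c-w6` g2 (AUTOFILL #2 PART 2 item (3)), brick §4(d) of the LEAD memo
`Cruxes/SplitBadTwoRankOneOfFacts/RULING-B23-g13.md` for crux `PrintCf2RubinValueTwo.TwoVariableMainConjAtSplitTwo`
(stmt-BirchSwinnertonDyer-23720, S3a), part II (d). The companion files show: (i) the `θ`-coinvariants of Rubin's exact
sequence (5) form a complex whose homology defects are killed by `#Δ′` (`…CoinvariantFourTerm`), and (ii) a four-term
complex with PSEUDO-NULL defects gives the same characteristic-ideal identities as an exact one
(`…FourTermPseudoNull`, `…TwoVariableMCOfBricksPseudoNull`). This file is the bridge (i) ⟹ (ii): over a Noetherian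
domain `R` with a prime element `π` (so `(π)` is a height-one prime), a module `M` in which every element is killed by
a power of `π` is pseudo-null iff `M_{(π)} = 0`, i.e. iff every element is ALSO killed by some `r ∉ (π)` («`μ_π(M) = 0`»;
at `R = Λ₂`, `π = p`: the `μ`-invariant condition at the prime `(p)`). For a module killed by `#Δ′ = p^a` this is the
EXACT price of the passage `p ∣ #Δ′` (e.g. `Λ₂/p` is killed by `p` and NOT pseudo-null: `char = (p)`):

* §1 `μ_π = 0` pointwise (`∀ m, ∃ r ∉ (π), r • m = 0`) passes to submodules, images and extensions
  (`…_submodule`, `…_of_surjective`, `…_of_exact`) — so to every subquotient of `N^k` once it holds for `N`;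
* §2 **`isPseudoNull_of_exists_pow_smul_eq_zero_of_forall`**: `π`-primary ∧ `μ_π = 0` ⟹ pseudo-null;
* §3 the link with the tree's local length and characteristic ideal: `μ_𝔭 = 0` iff `lengthAt R M 𝔭 = 0`; for `M`
  finitely generated torsion and `𝔭` of height one, `lengthAt R M 𝔭 ≠ 0 ⟹ char M ≤ 𝔭`
  (`charIdeal_le_of_lengthAt_ne_zero`), hence **`char M ⊄ (π)` ⟹ `μ_π(M) = 0`**
  (`forall_exists_smul_eq_zero_of_not_charIdeal_le`; with `char M = (f)`: `π ∤ f` suffices,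
  `…_of_charIdeal_eq_span_of_not_dvd`) — the form in which (c) `char(U_v/C̄)_θ·𝒪 = (𝓛_v)` with `μ(𝓛_v) = 0`
  (Oukhaba–Viguié at `p = 2, 3`) feeds the criterion;
* §4 `R = Λ₂ = IwasawaAlgebra₂ p`, `π = p`: `prime_natCast_iwasawaAlgebra₂` and
  `isPseudoNull_iwasawaAlgebra₂_of_pPrimary_of_forall`.

THEOREMS ONLY (no `def`, no named fact, no `sorry`); Theses-free; nothing about any curve or field; `--supports` the crux
as a helper. BSD is not proved by any of this; no summit statement is proved here.

References: Neukirch–Schmidt–Wingberg, *Cohomology of Number Fields*, V §1 (5.1.4)–(5.1.6), V §3 (5.3.9)–(5.3.10)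
(`μ`-invariant = multiplicity at `(p)`) [NeukirchSchmidtWingberg2008]; N. Bourbaki, *Algèbre commutative* VII §4.4;
K. Rubin, Invent. Math. 103 (1991), §4–§6 [Rubin1991]; H. Oukhaba, S. Viguié, Forum Math. 28 (2016) (`μ = 0` for the
Katz–de Shalit measures at `p = 2, 3`) [OukhabaViguie2016MuInvariant].
-/

noncomputable section

set_option linter.dupNamespace false -- D-0017: single-problem summit, `…BirchSwinnertonDyer.BirchSwinnertonDyer…` repeats a namespace by design
set_option autoImplicit false

open scoped Classical

namespace Summit.BirchSwinnertonDyer.BirchSwinnertonDyer.Theorems.PrintCf2.FourTerm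

open Literature.NumberTheory.EllipticCurves

universe u₁ u₂ u₃

variable {R : Type*} [CommRing R] {M : Type u₁} [AddCommGroup M] [Module R M]
  {M' : Type u₂} [AddCommGroup M'] [Module R M'] {M'' : Type u₃} [AddCommGroup M''] [Module R M'']

/-! ## §1. `μ_𝔭 = 0` pointwise and its inheritance -/

/-- `μ_𝔭 = 0` passes to submodules. [cite: NeukirchSchmidtWingberg2008, Ch. V §1, (5.1.4) Remark 1] -/
theorem forall_exists_smul_eq_zero_submodule {I : Ideal R} (h : ∀ m : M, ∃ r ∉ I, r • m = 0)
    (N : Submodule R M) : ∀ n : N, ∃ r ∉ I, r • n = 0 := by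
  intro n
  obtain ⟨r, hr, hrn⟩ := h (n : M)
  exact ⟨r, hr, Subtype.ext (by simpa using hrn)⟩

/-- `μ_𝔭 = 0` passes to images (quotients). [cite: NeukirchSchmidtWingberg2008, Ch. V §1, (5.1.4) Remark 1] -/
theorem forall_exists_smul_eq_zero_of_surjective {I : Ideal R} (h : ∀ m : M, ∃ r ∉ I, r • m = 0)
    (f : M →ₗ[R] M'') (hf : Function.Surjective f) : ∀ x : M'', ∃ r ∉ I, r • x = 0 := by
  intro x
  obtain ⟨m, rfl⟩ := hf x
  obtain ⟨r, hr, hrm⟩ := h m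
  exact ⟨r, hr, by rw [← map_smul, hrm, map_zero]⟩

/-- `μ_𝔭 = 0` passes to extensions: if `M' → M → M''` is exact (at `M`) and both `M'`, `M''` have `μ_𝔭 = 0` then so
has `M` (`𝔭` prime: `r'' m ∈ im M'`, `r' r'' m = 0`, `r' r'' ∉ 𝔭`). With the two previous lemmas: `μ_𝔭 = 0` for `N`
gives `μ_𝔭 = 0` for every subquotient of `N^k` — the home of the `H_i(Δ′, N)`-defects.
[cite: NeukirchSchmidtWingberg2008, Ch. V §1, (5.1.4) Remark 1] -/
theorem forall_exists_smul_eq_zero_of_exact {I : Ideal R} [I.IsPrime] (f : M' →ₗ[R] M) (g : M →ₗ[R] M'')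
    (hfg : Function.Exact f g) (h' : ∀ m : M', ∃ r ∉ I, r • m = 0) (h'' : ∀ x : M'', ∃ r ∉ I, r • x = 0) :
    ∀ m : M, ∃ r ∉ I, r • m = 0 := by
  intro m
  obtain ⟨r'', hr'', h0⟩ := h'' (g m)
  have hmem : r'' • m ∈ LinearMap.range f := by
    rw [← hfg.linearMap_ker_eq, LinearMap.mem_ker, map_smul, h0]
  obtain ⟨m', hm'⟩ := hmem
  obtain ⟨r', hr', h0'⟩ := h' m'
  refine ⟨r' * r'', fun hmul ↦ (‹I.IsPrime›.mem_or_mem hmul).elim hr' hr'', ?_⟩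
  rw [mul_smul, ← hm', ← map_smul, h0', map_zero]

/-! ## §2. `π`-primary modules with `μ_π = 0` are pseudo-null -/

/-- **A `π`-primary module with `μ_π = 0` is pseudo-null.** Over a Noetherian domain `R` with a prime element `π`
(`(π)` is then a height-one prime): if every `m ∈ M` is killed by a power of `π` AND by some `r ∉ (π)`, then `M_𝔭 = 0`
for every prime `𝔭` of height `≤ 1` — for `π ∉ 𝔭` the powers of `π` are units at `𝔭`, and a prime `𝔭 ∋ π` of height
`≤ 1` IS `(π)` (`(π) < 𝔭` would force `height 𝔭 > 1`). No finiteness needed. The converse implication (pseudo-null ⟹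
`μ_π = 0`) is the definition at `𝔭 = (π)`. [cite: NeukirchSchmidtWingberg2008, Ch. V §1, (5.1.4)–(5.1.6)] -/
theorem isPseudoNull_of_exists_pow_smul_eq_zero_of_forall [IsNoetherianRing R] [IsDomain R] {π : R}
    (hπ : Prime π) (hM : ∀ m : M, ∃ a : ℕ, π ^ a • m = 0)
    (hμ : ∀ m : M, ∃ r ∉ Ideal.span {π}, r • m = 0) : Module.IsPseudoNull R M := by
  haveI hprime : (Ideal.span {π}).IsPrime := (Ideal.span_singleton_prime hπ.ne_zero).mpr hπ
  intro 𝔭 h𝔭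
  rw [LocalizedModule.subsingleton_iff]
  intro m
  by_cases hπ𝔭 : π ∈ 𝔭.asIdeal
  · -- `𝔭 = (π)`
    have hle : Ideal.span {π} ≤ 𝔭.asIdeal := (Ideal.span_singleton_le_iff_mem _).mpr hπ𝔭
    have heq : Ideal.span {π} = 𝔭.asIdeal := by
      by_contra hne
      have hlt : Ideal.span {π} < 𝔭.asIdeal := lt_of_le_of_ne hle hne
      haveI : (Ideal.span {π}).FiniteHeight := by
        rw [Ideal.finiteHeight_iff, Module.height_span_singleton_eq_one_of_prime hπ]
        exact Or.inr ENat.one_ne_top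
      have h := Ideal.height_strict_mono_of_isPrime hlt
      rw [Module.height_span_singleton_eq_one_of_prime hπ] at h
      exact absurd h𝔭 (not_le.mpr h)
    obtain ⟨r, hr, hrm⟩ := hμ m
    exact ⟨r, fun hr𝔭 ↦ hr (heq ▸ hr𝔭), hrm⟩
  · obtain ⟨a, ha⟩ := hM m
    exact ⟨π ^ a, fun h ↦ hπ𝔭 (𝔭.isPrime.mem_of_pow_mem a h), ha⟩

/-! ## §3. `μ_𝔭 = 0`, the local length, and the characteristic ideal -/

/-- `μ_𝔭(M) = 0` pointwise is `lengthAt R M 𝔭 = 0` (`M_𝔭 = 0`). [cite: NeukirchSchmidtWingberg2008, Ch. V §1, (5.1.4) Remark 1] -/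
theorem forall_exists_smul_eq_zero_iff_lengthAt_eq_zero (𝔭 : PrimeSpectrum R) :
    (∀ m : M, ∃ r ∉ 𝔭.asIdeal, r • m = 0) ↔ Module.lengthAt R M 𝔭 = 0 := by
  rw [Module.lengthAt_eq_zero_iff, LocalizedModule.subsingleton_iff]
  exact forall_congr' fun m ↦ ⟨fun ⟨r, hr, h⟩ ↦ ⟨r, hr, h⟩, fun ⟨r, hr, h⟩ ↦ ⟨r, hr, h⟩⟩

/-- **`lengthAt R M 𝔭 ≠ 0 ⟹ char M ≤ 𝔭`** for `M` finitely generated torsion over a Noetherian domain and `𝔭` of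
height one: the factor `𝔭 ^ length(M_𝔭)` of `char M = ∏_{ht 𝔮 = 1} 𝔮 ^ length(M_𝔮)` (a finite product) divides it.
[cite: NeukirchSchmidtWingberg2008, Ch. V §3, (5.3.9)–(5.3.10)] -/
theorem charIdeal_le_of_lengthAt_ne_zero [IsNoetherianRing R] [IsDomain R] [Module.Finite R M]
    (hM : Module.IsTorsion R M) (𝔭 : PrimeSpectrum R) (h1 : 𝔭.asIdeal.height = 1)
    (hn : Module.lengthAt R M 𝔭 ≠ 0) : Module.charIdeal R M ≤ 𝔭.asIdeal := by
  obtain ⟨s, hsann, hs0⟩ := Submodule.annihilator_top_inter_nonZeroDivisors hM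
  have hs : s ≠ 0 := nonZeroDivisors.ne_zero hs0
  have hsM : Module.IsTorsionBy R M s := fun x ↦ Submodule.mem_annihilator.mp hsann x Submodule.mem_top
  -- the product defining `char M` has finite multiplicative support
  let f : PrimeSpectrum R → Ideal R := fun 𝔮 ↦ 𝔮.asIdeal ^ (Module.lengthAt R M 𝔮).toNat
  have hfin : Function.HasFiniteMulSupport
      ({𝔮 : PrimeSpectrum R | 𝔮.asIdeal.height = 1}.mulIndicator f) := by
    rw [Function.HasFiniteMulSupport, Set.mulSupport_mulIndicator]
    exact Module.finite_heightOne_inter_mulSupport hs hsM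
  have hdvd := finprod_mem_dvd 𝔭 hfin
  rw [Set.mulIndicator_of_mem (show 𝔭 ∈ {𝔮 : PrimeSpectrum R | 𝔮.asIdeal.height = 1} from h1)] at hdvd
  have hchar : Module.charIdeal R M = ∏ᶠ 𝔮, {𝔮 : PrimeSpectrum R | 𝔮.asIdeal.height = 1}.mulIndicator f 𝔮 := by
    rw [Module.charIdeal, finprod_mem_def]
  rw [hchar]
  refine (Ideal.le_of_dvd hdvd).trans (Ideal.pow_le_self ?_)
  have htop : Module.lengthAt R M 𝔭 ≠ ⊤ := Module.lengthAt_ne_top_of_isTorsionBy hs hsM 𝔭 h1.le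
  exact fun h0 ↦ by
    rcases (ENat.toNat_eq_zero.mp h0) with h | h
    · exact hn h
    · exact htop h

/-- **`char M ⊄ 𝔭 ⟹ μ_𝔭(M) = 0`** (pointwise: every element of `M` is killed by some `r ∉ 𝔭`), for `M` finitely
generated torsion over a Noetherian domain and `𝔭` of height one.
[cite: NeukirchSchmidtWingberg2008, Ch. V §3, (5.3.9)–(5.3.10)] -/
theorem forall_exists_smul_eq_zero_of_not_charIdeal_le [IsNoetherianRing R] [IsDomain R] [Module.Finite R M]
    (hM : Module.IsTorsion R M) (𝔭 : PrimeSpectrum R) (h1 : 𝔭.asIdeal.height = 1)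
    (h : ¬ Module.charIdeal R M ≤ 𝔭.asIdeal) : ∀ m : M, ∃ r ∉ 𝔭.asIdeal, r • m = 0 := by
  rw [forall_exists_smul_eq_zero_iff_lengthAt_eq_zero]
  by_contra hn
  exact h (charIdeal_le_of_lengthAt_ne_zero hM 𝔭 h1 hn)

/-- **`char M = (f)` with `π ∤ f` ⟹ `μ_π(M) = 0`** — the form in which a main-conjecture-type identity
`char M = (f)` together with «`μ(f) = 0` at `π`» feeds the pseudo-nullity criterion of §2 (for `M` finitely generated
torsion over a Noetherian domain, `π` a prime element). [cite: NeukirchSchmidtWingberg2008, Ch. V §3, (5.3.9)–(5.3.10)] -/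
theorem forall_exists_smul_eq_zero_of_charIdeal_eq_span_of_not_dvd [IsNoetherianRing R] [IsDomain R]
    [Module.Finite R M] (hM : Module.IsTorsion R M) {π f : R} (hπ : Prime π)
    (hchar : Module.charIdeal R M = Ideal.span {f}) (hndvd : ¬ π ∣ f) :
    ∀ m : M, ∃ r ∉ Ideal.span {π}, r • m = 0 := by
  haveI hprime : (Ideal.span {π}).IsPrime := (Ideal.span_singleton_prime hπ.ne_zero).mpr hπ
  have h := forall_exists_smul_eq_zero_of_not_charIdeal_le hM ⟨Ideal.span {π}, hprime⟩
    (Module.height_span_singleton_eq_one_of_prime hπ) (by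
      rw [hchar, Ideal.span_singleton_le_iff_mem, Ideal.mem_span_singleton]
      exact hndvd)
  exact h

/-- **Pseudo-nullity from a characteristic-ideal bound**: a `π`-primary module `M` embedding into a finitely
generated torsion `N` with `char N ⊄ (π)` (so `μ_π(N) = 0`, inherited by `M` along the injection) is pseudo-null —
`isPseudoNull_of_exists_pow_smul_eq_zero_of_forall` with `hμ` supplied by
`forall_exists_smul_eq_zero_of_not_charIdeal_le`. (For a general subquotient of `N^k` combine §1 first.)
[cite: NeukirchSchmidtWingberg2008, Ch. V §1, (5.1.4)–(5.1.6); Ch. V §3, (5.3.9)–(5.3.10)] -/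
theorem isPseudoNull_of_injective_of_not_charIdeal_le [IsNoetherianRing R] [IsDomain R] {N : Type u₂}
    [AddCommGroup N] [Module R N] [Module.Finite R N] (hN : Module.IsTorsion R N) {π : R} (hπ : Prime π)
    (hchar : ¬ Module.charIdeal R N ≤ Ideal.span {π}) (g : M →ₗ[R] N) (hg : Function.Injective g)
    (hM : ∀ m : M, ∃ a : ℕ, π ^ a • m = 0) : Module.IsPseudoNull R M := by
  haveI hprime : (Ideal.span {π}).IsPrime := (Ideal.span_singleton_prime hπ.ne_zero).mpr hπ
  have hμN := forall_exists_smul_eq_zero_of_not_charIdeal_le hN ⟨Ideal.span {π}, hprime⟩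
    (Module.height_span_singleton_eq_one_of_prime hπ) hchar
  refine isPseudoNull_of_exists_pow_smul_eq_zero_of_forall hπ hM fun m ↦ ?_
  obtain ⟨r, hr, h0⟩ := hμN (g m)
  exact ⟨r, hr, hg (by rw [map_smul, h0, map_zero])⟩

/-! ## §4. `Λ₂ = ℤ_p⟦T₂⟧⟦T₁⟧`, `π = p` -/

section IwasawaTwo

variable {p : ℕ} [Fact p.Prime] {M₂ : Type u₁} [AddCommGroup M₂] [Module (IwasawaAlgebra₂ p) M₂]

/-- `p ∈ Λ₂ = ℤ_p⟦T₂⟧⟦T₁⟧` is a prime element (`Λ₂/p = 𝔽_p⟦T₂⟧⟦T₁⟧` is a domain): `p = C (C p)` and the tree's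
`prime_C_of_prime` twice (`IwasawaAlgebra.prime_C`). [cite: NeukirchSchmidtWingberg2008, Ch. V §3, (5.3.9)–(5.3.10)] -/
theorem prime_natCast_iwasawaAlgebra₂ : Prime ((p : ℕ) : IwasawaAlgebra₂ p) := by
  have h : ((p : ℕ) : IwasawaAlgebra₂ p) =
      PowerSeries.C (PowerSeries.C ((p : ℕ) : ℤ_[p]) : IwasawaAlgebra p) := by
    rw [map_natCast, map_natCast]
  rw [h]
  exact prime_C_of_prime (IwasawaAlgebra.prime_C p)

/-- **Over `Λ₂`: a `p`-primary module with `μ = 0` at `(p)` is pseudo-null** — the criterion by which the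
«killed by `#Δ′ = p^a`» defects of the `θ`-coinvariant four-term sequence (`…CoinvariantFourTerm`) become the
pseudo-null defects of `…TwoVariableMCOfBricksPseudoNull`. (`Λ₂/p` shows the `μ`-hypothesis cannot be dropped.)
[cite: NeukirchSchmidtWingberg2008, Ch. V §1, (5.1.4)–(5.1.6); Ch. V §3, (5.3.9)–(5.3.10)] -/
theorem isPseudoNull_iwasawaAlgebra₂_of_pPrimary_of_forall
    (hM : ∀ m : M₂, ∃ a : ℕ, ((p : ℕ) : IwasawaAlgebra₂ p) ^ a • m = 0)
    (hμ : ∀ m : M₂, ∃ r ∉ Ideal.span {((p : ℕ) : IwasawaAlgebra₂ p)}, r • m = 0) :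
    Module.IsPseudoNull (IwasawaAlgebra₂ p) M₂ :=
  isPseudoNull_of_exists_pow_smul_eq_zero_of_forall prime_natCast_iwasawaAlgebra₂ hM hμ

/-- **Over `Λ₂`: a `p`-primary module embedding into a finitely generated torsion `N` with `char N ⊄ (p)` (`μ(N) = 0`)
is pseudo-null.** [cite: NeukirchSchmidtWingberg2008, Ch. V §1, (5.1.4)–(5.1.6); Ch. V §3, (5.3.9)–(5.3.10)] -/
theorem isPseudoNull_iwasawaAlgebra₂_of_injective_of_not_charIdeal_le {N : Type u₂} [AddCommGroup N]
    [Module (IwasawaAlgebra₂ p) N] [Module.Finite (IwasawaAlgebra₂ p) N]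
    (hN : Module.IsTorsion (IwasawaAlgebra₂ p) N)
    (hchar : ¬ Module.charIdeal (IwasawaAlgebra₂ p) N ≤ Ideal.span {((p : ℕ) : IwasawaAlgebra₂ p)})
    (g : M₂ →ₗ[IwasawaAlgebra₂ p] N) (hg : Function.Injective g)
    (hM : ∀ m : M₂, ∃ a : ℕ, ((p : ℕ) : IwasawaAlgebra₂ p) ^ a • m = 0) :
    Module.IsPseudoNull (IwasawaAlgebra₂ p) M₂ :=
  isPseudoNull_of_injective_of_not_charIdeal_le hN prime_natCast_iwasawaAlgebra₂ hchar g hg hM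

end IwasawaTwo

end Summit.BirchSwinnertonDyer.BirchSwinnertonDyer.Theorems.PrintCf2.FourTerm

end
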